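import Summits.KontsevichZagierPeriods.KontsevichZagierPeriods.Theorems.SoloInformedToricFace
import HarnessLib

/-!
# THEOREM ND — the cube-nondegenerate toric rung of the cube crux

Solo programme `solo-KontsevichZagierPeriods-informed`, session s104.

THEOREM TOR (`soloInformed_presentable_of_posRational`, file `SoloInformedToricSector`) presents
`[[0,1]ⁿ, x^p/Q]` inside the KZ calculus by cube integrals of germs holomorphic near the closed cube
when `Q ∈ ℚ[x₁, …, xₙ]` has positive coefficients.  Here the hypothesis is weakened to the
Newton-polyhedron condition of `SoloInformedToricFace`:

* `soloInformed_presentable_toricChart_of_ne` — the one-chart presentation lemma under the sole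
  hypothesis that the chart quotient `Q_A` has no zero on the closed cube `[0,1]ⁿ` (bound on `Q_A`
  by compactness instead of by the coefficient sum);
* `soloInformed_presentable_of_nondegenerate` — **THEOREM ND**: if `Q` is cube-nondegenerate
  (`SoloInformedCubeNondegenerate Q`: no initial form `in_w(Q)`, `w ∈ ℕⁿ`, vanishes on `(0,1]ⁿ`) then
  every `IntegralRep` on `[0,1]ⁿ` whose integrand agrees with `x^p / Q(x)` on the open cube is
  presentable (`of r ∈ soloInformedPresentable`), in every dimension `n`, with no boundary
  regularity assumed beyond the integrability built into `IntegralRep`;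
* `soloInformed_cubeResolution_nondegenerate` — the same in the output format of the crux
  `SoloInformedAyoubCubeResolutionCube`.

By `soloInformed_cubeNondegenerate_of_pos` THEOREM ND contains THEOREM TOR; it also covers
denominators vanishing at a corner with a nondegenerate principal part, e.g. `x + y − xy`
(`ζ(2) = ∫∫ dx dy/(1 − xy)` after the corner move `x ↦ 1 − x, y ↦ 1 − y`; the two charts of the
blow-up of the origin give `ζ(2) = 2 ∫∫ du dv/(1 + v − uv)` with `1 + v − uv ≥ 1` on `[0,1]²`),
`x + y`, `x² + y³`, `x + y + z − xyz`, … .  Denominators such as `1 − xy` (zero at the far corner) or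
`(x − y)² + x³` (degenerate principal part) are not covered: the former needs the dyadic corner
charts first, the latter a genuine (non-toric) blow-up — the bridge (B1)–(B3) of the s103 census.

## Proof
Identical to THEOREM TOR (toric charts with chain exponents
`MonomialCubeChart.exists_cube_charts_pairwise_comparable`, Jacobian formula
`soloInformed_abs_det_monoD`, integrability test `soloInformed_le_of_integrableOn_monomialRatio`,
Nash-image lemma), the positivity of `Q_A` on the closed cube being replaced by THE FACE LEMMA
`soloInformed_chartQuot_ne_zero_of_nondegenerate`.

References: A. G. Kouchnirenko, Invent. Math. 32 (1976) §1; A. N. Varchenko, Funct. Anal. Appl.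
10 (1976); J. Ayoub, EMS Newsl. 91 (2014), §2.2; M. Kontsevich, D. Zagier, *Periods* (2001), §1.2;
W. Fulton, *Introduction to Toric Varieties* (1993), §2.6.
-/

noncomputable section

open scoped BigOperators
open MeasureTheory Set
open Literature.NumberTheory.Transcendental Literature.NumberTheory.Transcendental.KZ
open Literature.ModelTheory.ExponentialFields (IsSemialgebraic)
open Literature.AlgebraicGeometry.Resolution

namespace Summit.KontsevichZagierPeriods.KontsevichZagierPeriods.Theorems

variable {n : ℕ}

/-- A cube-nondegenerate polynomial is non-zero (`in_0(0) = 0` vanishes at `(1, …, 1)`).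
[this work] -/
theorem soloInformed_ne_zero_of_cubeNondegenerate {Q : MvPolynomial (Fin n) ℚ}
    (hND : SoloInformedCubeNondegenerate Q) : Q ≠ 0 := by
  rintro rfl
  exact hND 0 (fun _ => 1) (fun _ => ⟨one_pos, le_rfl⟩) (by simp [soloInformedInitForm])

/-! ### One toric chart, non-vanishing version -/

/-- **Presentation of one toric chart piece (non-vanishing version).**  Let `A` be an exponent
matrix with `det A ≠ 0`, `Q ∈ ℚ[x]` and `m ≤ Aᵀ a` for all `a ∈ supp Q` such that the chart quotient
`Q_A` has NO ZERO on the closed cube `[0,1]ⁿ`, and `R` an `IntegralRep` on the chart image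
`μ_A((0,1)ⁿ)` whose integrand there is `y^p / Q(y)`.  Then `of R` is presentable: the pulled-back
form is `Re` of the rational germ `|det A| · v^{Aᵀp + Aᵀ1 − m − 1} / Q_A(v)`, the exponent being
non-negative by integrability. [this work] -/
theorem soloInformed_presentable_toricChart_of_ne (A : Matrix (Fin n) (Fin n) ℕ)
    (hA : (A.map (fun t : ℕ => (t : ℝ))).det ≠ 0) (p : Fin n → ℕ) (Q : MvPolynomial (Fin n) ℚ)
    (m : Fin n → ℕ) (hmin : ∀ a ∈ Q.support, ∀ j, m j ≤ ∑ i, A i j * a i)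
    (hQc : ∀ x : Fin n → ℝ, (∀ j, 0 ≤ x j ∧ x j ≤ 1) →
      MvPolynomial.aeval x (soloInformedChartQuot A Q m) ≠ 0)
    (R : IntegralRep n)
    (hdom : R.domain =
      (fun (v : Fin n → ℝ) (i : Fin n) => ∏ j, v j ^ A i j) '' soloInformedOpenCube n)
    (hRi : ∀ v ∈ soloInformedOpenCube n, R.integrand (fun i => ∏ j, v j ^ A i j) =
      (∏ i, (∏ j, v j ^ A i j) ^ p i) / MvPolynomial.aeval (fun i => ∏ j, v j ^ A i j) Q) :
    of R ∈ soloInformedPresentable := by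
  classical
  have hO := soloInformedOpenCube_eq_pi n
  have hQc_ne : ∀ v ∈ soloInformedOpenCube n,
      MvPolynomial.aeval v (soloInformedChartQuot A Q m) ≠ 0 :=
    fun v hv => hQc v fun j => ⟨(hv j).1.le, (hv j).2.le⟩
  -- (★) the pulled-back integrand times the Jacobian
  have hkey : ∀ v ∈ soloInformedOpenCube n,
      R.integrand (fun i => ∏ j, v j ^ A i j) * |(soloInformedMonoD A v).det| =
        |(A.map (fun t : ℕ => (t : ℝ))).det| *
          ((∏ j, v j ^ ((∑ i, A i j * p i) + ∑ i, A i j)) /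
            ((∏ j, v j ^ (m j + 1)) * MvPolynomial.aeval v (soloInformedChartQuot A Q m))) := by
    intro v hv
    have hv0 : ∀ j, 0 < v j := fun j => (hv j).1
    have hnum : (∏ i, (∏ j, v j ^ A i j) ^ p i) = ∏ j, v j ^ (∑ i, A i j * p i) :=
      prod_pow_monomialMap A p (fun i => rfl)
    rw [hRi v hv, soloInformed_abs_det_monoD A hv0, hnum,
      soloInformed_aeval_monomialMap_eq A Q m hmin v]
    have hU : (∏ j, v j ^ ((∑ i, A i j * p i) + ∑ i, A i j)) =
        (∏ j, v j ^ (∑ i, A i j * p i)) * ∏ j, v j ^ (∑ i, A i j) := by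
      rw [← Finset.prod_mul_distrib]
      exact Finset.prod_congr rfl fun j _ => pow_add _ _ _
    have hW : (∏ j, v j ^ (m j + 1)) = (∏ j, v j ^ m j) * ∏ j, v j := by
      rw [← Finset.prod_mul_distrib]
      exact Finset.prod_congr rfl fun j _ => pow_succ _ _
    rw [hU, hW]
    have h1 : (∏ j, v j) ≠ 0 := Finset.prod_ne_zero_iff.2 fun j _ => (hv0 j).ne'
    have h2 : (∏ j, v j ^ m j) ≠ 0 :=
      Finset.prod_ne_zero_iff.2 fun j _ => pow_ne_zero _ (hv0 j).ne'
    have h3 : MvPolynomial.aeval v (soloInformedChartQuot A Q m) ≠ 0 := hQc_ne v hv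
    field_simp
  -- measurability, derivative and injectivity on the open cube
  have hmeasO : MeasurableSet (soloInformedOpenCube n) := by
    rw [hO]; exact MeasurableSet.univ_pi fun _ => measurableSet_Ioo
  have hderiv : ∀ x ∈ soloInformedOpenCube n, HasFDerivWithinAt
      (fun (v : Fin n → ℝ) (i : Fin n) => ∏ j, v j ^ A i j) (soloInformedMonoD A x)
      (soloInformedOpenCube n) x :=
    fun x _ => soloInformed_hasFDerivWithinAt_monomialMap A _ x
  have hinj : InjOn (fun (v : Fin n → ℝ) (i : Fin n) => ∏ j, v j ^ A i j)
      (soloInformedOpenCube n) := by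
    rw [hO]; exact injOn_monomialMap_pi_Ioo hA
  -- integrability of the pulled-back form (change of variables) ...
  have hint1 : IntegrableOn (fun v => |(soloInformedMonoD A v).det| •
      R.integrand (fun i => ∏ j, v j ^ A i j)) (soloInformedOpenCube n) := by
    have h := R.integrableOn
    rw [hdom, integrableOn_image_iff_integrableOn_abs_det_fderiv_smul volume hmeasO hderiv hinj]
      at h
    exact h
  -- continuity of `v ↦ Q_A(v)` and a bound on the closed cube (compactness)
  have hcont : Continuous fun v : Fin n → ℝ =>
      (MvPolynomial.aeval v (soloInformedChartQuot A Q m) : ℝ) := by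
    have h : (fun v : Fin n → ℝ => (MvPolynomial.aeval v (soloInformedChartQuot A Q m) : ℝ)) =
        fun v => MvPolynomial.eval v
          (MvPolynomial.map (algebraMap ℚ ℝ) (soloInformedChartQuot A Q m)) :=
      funext fun v => by rw [MvPolynomial.eval_map, MvPolynomial.aeval_def]
    rw [h]
    exact MvPolynomial.continuous_eval _
  obtain ⟨C, hC⟩ : ∃ C : ℝ, ∀ x ∈ soloInformedCube n,
      ‖(MvPolynomial.aeval x (soloInformedChartQuot A Q m) : ℝ)‖ ≤ C := by
    have hK : IsCompact (soloInformedCube n) := by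
      rw [soloInformedCube_eq_Icc]; exact isCompact_Icc
    exact hK.exists_bound_of_continuousOn hcont.continuousOn
  -- ... hence of the monomial ratio `v^U / v^{m+1}` (the factor `Q_A/|det A|` is bounded)
  have hratio : IntegrableOn (fun v : Fin n → ℝ =>
      (∏ j, v j ^ ((∑ i, A i j * p i) + ∑ i, A i j)) / ∏ j, v j ^ (m j + 1))
      (Set.pi univ fun _ : Fin n => Ioo (0 : ℝ) 1) := by
    rw [← hO]
    have hb : IntegrableOn (fun v => (MvPolynomial.aeval v (soloInformedChartQuot A Q m) /
        |(A.map (fun t : ℕ => (t : ℝ))).det|) * (|(soloInformedMonoD A v).det| •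
        R.integrand (fun i => ∏ j, v j ^ A i j))) (soloInformedOpenCube n) := by
      refine Integrable.bdd_mul hint1 ((hcont.div_const _).aestronglyMeasurable)
        (c := C / |(A.map (fun t : ℕ => (t : ℝ))).det|)
        (ae_restrict_of_forall_mem hmeasO fun v hv => ?_)
      rw [Real.norm_eq_abs, abs_div, abs_abs]
      exact div_le_div_of_nonneg_right
        (by simpa [Real.norm_eq_abs] using hC v (soloInformedOpenCube_subset_cube n hv))
        (abs_nonneg _)
    refine hb.congr_fun (fun v hv => ?_) hmeasO
    have hv0 : ∀ j, 0 < v j := fun j => (hv j).1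
    dsimp only
    rw [smul_eq_mul, mul_comm |(soloInformedMonoD A v).det|, hkey v hv]
    have h1 : (∏ j, v j ^ (m j + 1)) ≠ 0 :=
      Finset.prod_ne_zero_iff.2 fun j _ => pow_ne_zero _ (hv0 j).ne'
    have h3 : MvPolynomial.aeval v (soloInformedChartQuot A Q m) ≠ 0 := hQc_ne v hv
    have h4 : |(A.map (fun t : ℕ => (t : ℝ))).det| ≠ 0 := abs_ne_zero.2 hA
    field_simp
  -- the exponent `U − m − 1` is non-negative
  have hle : ∀ j, m j + 1 ≤ (∑ i, A i j * p i) + ∑ i, A i j :=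
    soloInformed_le_of_integrableOn_monomialRatio _ _ hratio
  obtain ⟨e, he⟩ : ∃ e : Fin n → ℕ, ∀ j, (∑ i, A i j * p i) + ∑ i, A i j = (m j + 1) + e j :=
    ⟨fun j => ((∑ i, A i j * p i) + ∑ i, A i j) - (m j + 1),
      fun j => (Nat.add_sub_cancel' (hle j)).symm⟩
  -- the germ `|det A| · X^e / Q_A`
  have hQcC : ∀ x ∈ soloInformedCube n,
      MvPolynomial.aeval (soloInformedToC n x) (soloInformedChartQuot A Q m) ≠ 0 := by
    intro x hx
    have h := soloInformed_ofReal_aeval x (soloInformedChartQuot A Q m)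
    simp only [← soloInformedToC_apply] at h
    rw [← h, Complex.ofReal_ne_zero]
    exact hQc x (soloInformed_mem_cube_iff.1 hx)
  refine soloInformed_presentable_of_nashImage R (fun (v : Fin n → ℝ) (i : Fin n) => ∏ j, v j ^ A i j)
    (soloInformedMonoD A)
    (soloInformedRationalGerm (MvPolynomial.C |(A.map (fun t : ℕ => (t : ℚ))).det| *
      ∏ j, MvPolynomial.X j ^ e j) (soloInformedChartQuot A Q m) hQcC)
    (isSemialgebraicMapOn_monomialMap A (isSemialgebraic_soloInformedOpenCube n))
    hderiv hinj hdom fun v hv => ?_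
  -- the integrand identity on the open cube
  have hv0 : ∀ j, 0 < v j := fun j => (hv j).1
  show (MvPolynomial.aeval (soloInformedToC n v)
      (MvPolynomial.C |(A.map (fun t : ℕ => (t : ℚ))).det| * ∏ j, MvPolynomial.X j ^ e j) /
    MvPolynomial.aeval (soloInformedToC n v) (soloInformedChartQuot A Q m)).re = _
  have hp := soloInformed_ofReal_aeval v
    (MvPolynomial.C |(A.map (fun t : ℕ => (t : ℚ))).det| * ∏ j, MvPolynomial.X j ^ e j)
  have hq := soloInformed_ofReal_aeval v (soloInformedChartQuot A Q m)
  simp only [← soloInformedToC_apply] at hp hq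
  rw [← hp, ← hq, ← Complex.ofReal_div, Complex.ofReal_re, hkey v hv]
  simp only [map_mul, MvPolynomial.aeval_C, map_prod, map_pow, MvPolynomial.aeval_X, eq_ratCast,
    Rat.cast_abs, soloInformed_ratCast_det_map]
  have hU : (∏ j, v j ^ ((∑ i, A i j * p i) + ∑ i, A i j)) =
      (∏ j, v j ^ (m j + 1)) * ∏ j, v j ^ e j := by
    rw [← Finset.prod_mul_distrib]
    exact Finset.prod_congr rfl fun j _ => by rw [he j, pow_add]
  rw [hU]
  have h1 : (∏ j, v j ^ (m j + 1)) ≠ 0 :=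
    Finset.prod_ne_zero_iff.2 fun j _ => pow_ne_zero _ (hv0 j).ne'
  have h3 : MvPolynomial.aeval v (soloInformedChartQuot A Q m) ≠ 0 := hQc_ne v hv
  field_simp

/-! ### THEOREM ND -/

/-- **THEOREM ND — the cube-nondegenerate toric rung of the cube crux.**  Let `r` be an
`IntegralRep` on the closed cube `[0,1]ⁿ` whose integrand agrees on the open cube with
`x^p / Q(x)`, where `p ∈ ℕⁿ` and `Q ∈ ℚ[x₁, …, xₙ]` is CUBE-NONDEGENERATE: no initial form
`in_w(Q)` (`w ∈ ℕⁿ`) has a zero in `(0,1]ⁿ`.  Then `of r` is presentable: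
`k • of r − ∑ⱼ cⱼ • of ρⱼ ∈ KZ.relations` for some `k ≠ 0` and finitely many cube integrals `ρⱼ` of
real parts of germs holomorphic near the closed cube (in fact `k = 1`, `cⱼ = 1`).  Contains
THEOREM TOR (positive coefficients) and e.g. the presentation of `[[0,1]², 1/(x + y − xy)] = ζ(2)`.
[this work; Kouchnirenko 1976 / Varchenko 1976 (Newton nondegeneracy, toric resolution);
Ayoub 2014 §2.2 (format); KKMS 1973 / Fulton 1993 §2.6 (toric charts)] -/
theorem soloInformed_presentable_of_nondegenerate (p : Fin n → ℕ) (Q : MvPolynomial (Fin n) ℚ)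
    (hND : SoloInformedCubeNondegenerate Q) (r : IntegralRep n)
    (hr : r.domain = soloInformedCube n)
    (hri : EqOn r.integrand (fun x => (∏ j, x j ^ p j) / MvPolynomial.aeval x Q)
      (soloInformedOpenCube n)) :
    of r ∈ soloInformedPresentable := by
  classical
  have hQ0 : Q ≠ 0 := soloInformed_ne_zero_of_cubeNondegenerate hND
  have hO := soloInformedOpenCube_eq_pi n
  obtain ⟨M, A, hdet, hdisj, hcov, hcmp⟩ :=
    MonomialCubeChart.exists_cube_charts_pairwise_comparable n
      (Q.support.image fun a : Fin n →₀ ℕ => (a : Fin n → ℕ))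
  rw [← hO] at hdisj hcov
  have hne : Q.support.Nonempty :=
    Finset.nonempty_iff_ne_empty.2 fun h => hQ0 (MvPolynomial.support_eq_empty.1 h)
  have hmaps : ∀ c, MapsTo (fun (v : Fin n → ℝ) (i : Fin n) => ∏ j, v j ^ A c i j)
      (soloInformedOpenCube n) (soloInformedOpenCube n) := fun c => by
    rw [hO]; exact monomialMap_mapsTo_pi_Ioo (hdet c)
  have himg : ∀ c, IsSemialgebraic ℚ
      ((fun (v : Fin n → ℝ) (i : Fin n) => ∏ j, v j ^ A c i j) '' soloInformedOpenCube n) :=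
    fun c => IsSemialgebraicMapOn.isSemialgebraic_image_holds
      (isSemialgebraicMapOn_monomialMap (A c) (isSemialgebraic_soloInformedOpenCube n))
      Subset.rfl (isSemialgebraic_soloInformedOpenCube n)
  have hsub : ∀ c, (fun (v : Fin n → ℝ) (i : Fin n) => ∏ j, v j ^ A c i j) ''
      soloInformedOpenCube n ⊆ r.domain := fun c => by
    rw [hr]; exact (hmaps c).image_subset.trans (soloInformedOpenCube_subset_cube n)
  -- the chart pieces
  set R : Fin M → IntegralRep n := fun c =>
    r.restrict ((fun (v : Fin n → ℝ) (i : Fin n) => ∏ j, v j ^ A c i j) '' soloInformedOpenCube n)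
      (himg c) (hsub c) with hR
  have hRdom : ∀ c, (R c).domain =
      (fun (v : Fin n → ℝ) (i : Fin n) => ∏ j, v j ^ A c i j) '' soloInformedOpenCube n :=
    fun c => rfl
  have hpiece : ∀ c, of (R c) ∈ soloInformedPresentable := by
    intro c
    obtain ⟨a₀, ha₀, hmin⟩ := soloInformed_exists_least_of_pairwise_comparable Q.support hne
      (fun (a : Fin n →₀ ℕ) (j : Fin n) => ∑ i, A c i j * a i) fun a ha b hb =>
        hcmp c _ (Finset.mem_image_of_mem _ ha) _ (Finset.mem_image_of_mem _ hb)
    exact soloInformed_presentable_toricChart_of_ne (A c) (hdet c) p Q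
      (fun j => ∑ i, A c i j * a₀ i) hmin
      (fun x hx => soloInformed_chartQuot_ne_zero_of_nondegenerate (A c) Q hND ha₀
        (fun j => rfl) hmin hx)
      (R c) (hRdom c) fun v hv => hri (hmaps c hv)
  -- gluing by domain additivity up to null sets
  have hU : (⋃ c ∈ (Finset.univ : Finset (Fin M)), (R c).domain) =
      ⋃ c, (fun (v : Fin n → ℝ) (i : Fin n) => ∏ j, v j ^ A c i j) '' soloInformedOpenCube n := by
    simp only [Finset.mem_univ, Set.iUnion_true, hRdom]
  have hglue : of r - ∑ c, of (R c) ∈ relations := by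
    refine of_sub_sum_of_mem_relations Finset.univ r R (fun c _ => ?_) (fun c _ _ _ => rfl) ?_ ?_
    · rw [hRdom, Set.sdiff_eq_empty.2 (hsub c)]; exact measure_empty
    · rw [hU, hr]
      refine measure_mono_null (fun x hx => ?_)
        (measure_union_null (soloInformed_volume_cube_diff_openCube n) hcov)
      by_cases hxo : x ∈ soloInformedOpenCube n
      · exact Or.inr ⟨hxo, hx.2⟩
      · exact Or.inl ⟨hx.1, hxo⟩
    · intro c _ c' _ hcc'
      rw [hRdom, hRdom, (hdisj hcc').inter_eq]; exact measure_empty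
  exact soloInformed_presentable_of_sub_mem hglue
    (soloInformed_presentable_sum _ _ fun c _ => hpiece c)

/-- **THEOREM ND in the output format of the cube crux** `SoloInformedAyoubCubeResolutionCube`:
rational integrands `x^p/Q` on `[0,1]ⁿ` with cube-nondegenerate `Q` admit an Ayoub cube resolution
inside the KZ calculus. [this work] -/
theorem soloInformed_cubeResolution_nondegenerate (p : Fin n → ℕ) (Q : MvPolynomial (Fin n) ℚ)
    (hND : SoloInformedCubeNondegenerate Q) (r : IntegralRep n)
    (hr : r.domain = soloInformedCube n)
    (hri : EqOn r.integrand (fun x => (∏ j, x j ^ p j) / MvPolynomial.aeval x Q)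
      (soloInformedOpenCube n)) :
    ∃ (k : ℕ) (_ : k ≠ 0) (m : ℕ) (d : Fin m → ℕ) (G : ∀ j, SoloInformedCubeGerm (d j))
      (c : Fin m → ℤ) (ρ : ∀ j, IntegralRep (d j)),
      (∀ j, (ρ j).domain = soloInformedCube (d j)) ∧
      (∀ j, EqOn (ρ j).integrand (fun x => ((G j).g (soloInformedToC (d j) x)).re)
        (soloInformedCube (d j))) ∧
      k • of r - ∑ j, c j • of (ρ j) ∈ relations :=
  soloInformed_exists_fin_of_presentable (soloInformed_presentable_of_nondegenerate p Q hND r hr hri)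

end Summit.KontsevichZagierPeriods.KontsevichZagierPeriods.Theorems
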